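import Summits.QuantumFields.BalabanUV.T4Continuum.Support.HodgeCorrectionLaws
import Summits.QuantumFields.BalabanUV.T4Continuum.Support.RegularBackgroundTower

/-!
# T⁴ programme, spine node NE2 (U1a), row B2.w — THE FEED of `HodgeCorrectionLaws`: the holonomy towers ARE bounded two-level-consistent
# colour data, given a (3.35)+(3.36)-shape regularity structure on the site transporters and NE3's consistency of the connection and of ALL
# its first difference quotients (where [B9] (3.36) enters the tier-B model)

NE2 formalisation swarm `t4-ne2-formalise-*`, leaf prover 10 (gen 2), leaf-proposed SUPPLIER row «B2.w-feed» (INTENT CLAIMS.log 2026-08-20; the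
owner may book / rename / refuse).  Row B2.w-laws (`Support/HodgeCorrectionLaws`, p210953) gives `hodgeCorr L M Rb` the target shape from
`hz : ∀ ν μ, BoundedBackgroundM L M (holTower L M Rb ν μ) α β`.  [Balaban1985BackgroundPropagators] p.396 prints the regularity class (3.35)
`|A| < O(1)Mα₀(Lʲη)⁻¹, |∇^ηA| < O(1)Mα₀(Lʲη)⁻²` and (3.36) `|∂^{η*}∂^ηA| < O(1)Mα₀(Lʲη)⁻³` («for the operators introduced until now we need only
the condition (3.35), but later on we will have to assume (3.36) also»).  THIS FILE shows where (3.36) enters.  With `R = 1 + w/c` (`c = L^k`):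
  `holTower k (x, κ) = [D_μw_ν + (D_νw_μ)ᴴ](x − e_μ) + (w_ν(x)·w_μ(x + e_ν − e_μ)ᴴ − w_μ(x − e_μ)ᴴ·w_ν(x − e_μ))`  (**`holTower_eq`**,
`D_λw_ν(y) = c·(w_ν(y + e_λ) − w_ν(y))`), so (§2) its SIZE `≤ 2β + 2α²` needs only the (3.35) shapes (**`norm_holTower_le`**), while (§3) its
two-level CONSISTENCY at the block parent is that of a BACKWARD-SHIFTED first-difference field and costs (i) NE3's consistency of `w` (`βc`) AND of
ALL difference quotients `D_λw_ν` (`βD`; a larger class than row B5's `regClass = {w, D_νw_ν}`) and (ii) the lattice-Lipschitz bound `β₂` of the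
`D_λw_ν` = the (3.36) SHAPE, because `parT(x′ − e′_μ) = parT x′` off the low `μ`-face of a block: **`boundedBackgroundM_holTower`** —
`BoundedBackgroundM L M (holTower L M Rb ν μ) (2β + 2α²) (2(βD + β₂) + 4α(βc + β))`; (§4) **`perturbationLaws_hodgeCorrection_of_regular`** — the
row-B2.w law with binders = the hypothesis STRUCTURE `RegularSites Rb α β β₂`, the two displayed NE3-type consistencies, and the mixed-shift
`ShiftLaws` (the owner's `shiftLaws_mixed`); the bridges to rows B5/B6 (leaf-03's request: `RegularSites.toRegularTransporters` — ONE regularity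
binder serves B2 and B2.w —, `dconnTower_eq_DqT_tauInv`, `dconnTower_consistent`) are the companion `Support/HolonomyTowerRegularBridge`.  Row B5's shifted-site geometry
(`RegularBackgroundTower.parT_tauInv_cases_lev`, `norm_tauInv_sub_tauInv_parT_le`) is reused BY NAME; the forward dichotomy `parT_tau_cases_lev` is added.

HONEST FRAMING (T4-DAG p. 1).  Hypothesis STRUCTURES on DATA + bookkeeping OURS at MODEL LEVEL (site transporters `Rb`; no transporter constructed,
no regular gauge proved to exist — [Balaban1985RegularGauge] is where Bałaban gets (3.35)–(3.36)); (3.35)/(3.36) are SHAPE locators, nothing printed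
is a hypothesis of a theorem here; no B0; NOT [B9] (3.10)/(3.23)–(3.26) as printed; NE2 NOT PROVED; NOT infinite volume, NOT a mass gap, NOT Clay, NOT
summit progress; spine 0/9 unchanged.  HONEST DEPENDENCY: continuum YM on T⁴ ⇐ BetaPertH ∧ nine spine estimates (0/9 proved); BetaPertH ⇐ (D1) ∧
(D4) ∧ CAP+tail; G-an2-4 gates asym, D1 and NE2/3/4.  ABSOLUTE RULE kept; no `def … : Prop` fact; no `sorry`.
-/

noncomputable section
noncomputable section

open scoped BigOperators ComplexConjugate Matrix Matrix.Norms.L2Operator Kronecker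

namespace Summit.QuantumFields.BalabanUV.T4Continuum.HolonomyTowerRegular

open Literature.MathematicalPhysics.QuantumFieldTheory.Balaban1983to89.B5Prop11Plancherel
open Literature.MathematicalPhysics.QuantumFieldTheory.Balaban1983to89.B5G183RateUnitTower (lev lev_neZero)
open Summit.QuantumFields.BalabanUV.T4Continuum
open Summit.QuantumFields.BalabanUV.T4Continuum.BalabanAveragedTowerUnit (idx cast_lev' one_le_lev')
open Summit.QuantumFields.BalabanUV.T4Continuum.BackgroundResolventTower
open Summit.QuantumFields.BalabanUV.T4Continuum.BlockPairingGeometry (tau parT par_add_unitVec)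
open Summit.QuantumFields.BalabanUV.T4Continuum.AbelianCovariantLaplacian (tauInv tau_tauInv tauInv_tau star_natCast_complex)
open Summit.QuantumFields.BalabanUV.T4Continuum.ColourCovariantLaplacian (BoundedBackgroundM)
open Summit.QuantumFields.BalabanUV.T4Continuum.TransportedSiteAveraging (Dc Jc)
open Summit.QuantumFields.BalabanUV.T4Continuum.ShiftedZerothOrder (ShiftLaws)
open Summit.QuantumFields.BalabanUV.T4Continuum.RegularBackgroundTower (lev_pos parT_tauInv_cases_lev norm_sub_parT_tauInv_le
  norm_tauInv_sub_tauInv_parT_le)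
open Summit.QuantumFields.BalabanUV.T4Continuum.HodgeCorrectionLaws (holField holTower hodgeCorr perturbationLaws_hodgeCorrection_of_shiftLaws)

variable {d : ℕ} (L : ℕ) [NeZero L] (M : Fin d → ℕ) [hM : ∀ μ, NeZero (M μ)] {o : Type*} [Fintype o] [DecidableEq o]

/-! ## §1 The connection and its difference quotients, slot-lifted; the exact decomposition of the holonomy tower -/

/-- the connection tower of slot-independent site transporters, read on the 1-form index: `w^{(k)}_ν(x, κ) = L^k·(R^{(k)}_ν(x) − 1)`.
[cite: Balaban1985BackgroundPropagators, (3.35) p.396 (shape: `A = η⁻¹(U − 1)`-type size)] [folklore] -/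
def wT (Rb : (k : ℕ) → Fin d → Tor (fine (lev L k) M) → Matrix o o ℂ) (k : ℕ) (ν : Fin d) (i : idx L M k) : Matrix o o ℂ :=
  ((lev L k : ℕ) : ℂ) • (Rb k ν i.1 - 1)

/-- the FORWARD DIFFERENCE-QUOTIENT towers `D_lam w_ν(y) = L^k·(w_ν(y + e_lam) − w_ν(y))` (all pairs `(lam, ν)` — the mixed derivatives included).
[cite: Balaban1985BackgroundPropagators, (3.35) p.396 (shape: `|∇^η A|`)] [folklore] -/
def DqT (Rb : (k : ℕ) → Fin d → Tor (fine (lev L k) M) → Matrix o o ℂ) (lam : Fin d) (k : ℕ) (ν : Fin d) (i : idx L M k) : Matrix o o ℂ :=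
  ((lev L k : ℕ) : ℂ) • (wT L M Rb k ν (tau (fine (lev L k) M) lam i) - wT L M Rb k ν i)

/-- the linear part of the holonomy tower: `A^{(k)}_{νμ} = D_μw_ν + (D_νw_μ)ᴴ` (read at `x − e_μ` below). [folklore] -/
def linPart (Rb : (k : ℕ) → Fin d → Tor (fine (lev L k) M) → Matrix o o ℂ) (ν μ : Fin d) (k : ℕ) (i : idx L M k) : Matrix o o ℂ :=
  DqT L M Rb μ k ν i + (DqT L M Rb ν k μ i)ᴴ

/-- the quadratic part of the holonomy tower: `B^{(k)}_{νμ}(x) = w_ν(x)·w_μ(x − e_μ + e_ν)ᴴ − w_μ(x − e_μ)ᴴ·w_ν(x − e_μ)`. [folklore] -/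
def quadPart (Rb : (k : ℕ) → Fin d → Tor (fine (lev L k) M) → Matrix o o ℂ) (ν μ : Fin d) (k : ℕ) (i : idx L M k) : Matrix o o ℂ :=
  wT L M Rb k ν i * (wT L M Rb k μ (tau (fine (lev L k) M) ν (tauInv (fine (lev L k) M) μ i)))ᴴ
    - (wT L M Rb k μ (tauInv (fine (lev L k) M) μ i))ᴴ * wT L M Rb k ν (tauInv (fine (lev L k) M) μ i)

omit hM [Fintype o] in
/-- `R = 1 + c⁻¹·w` (`c = L^k ≠ 0`). [folklore] -/
theorem Rb_eq (Rb : (k : ℕ) → Fin d → Tor (fine (lev L k) M) → Matrix o o ℂ) (k : ℕ) (ν : Fin d) (i : idx L M k) :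
    Rb k ν i.1 = 1 + (((lev L k : ℕ) : ℂ))⁻¹ • wT L M Rb k ν i := by
  have hc : (((lev L k : ℕ) : ℂ)) ≠ 0 := by exact_mod_cast (lev_neZero L k).ne
  rw [wT, smul_smul, inv_mul_cancel₀ hc, one_smul, add_sub_cancel]

omit hM in
/-- **THE EXACT DECOMPOSITION** `holTower k i = A_k(τ_μ⁻¹ i) + B_k(i)`: with `R = 1 + w/c`,
`c²·(R_ν(x)R_μ(y)ᴴ − R_μ(x′)ᴴR_ν(x′)) = c(w_ν(x) − w_ν(x′)) + c(w_μ(y) − w_μ(x′))ᴴ + (w_ν(x)w_μ(y)ᴴ − w_μ(x′)ᴴw_ν(x′))`, `x′ = x − e_μ`,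
`y = x′ + e_ν` (all linear terms cancel). [folklore] -/
theorem holTower_eq (Rb : (k : ℕ) → Fin d → Tor (fine (lev L k) M) → Matrix o o ℂ) (ν μ : Fin d) (k : ℕ) (i : idx L M k) :
    holTower L M Rb ν μ k i = linPart L M Rb ν μ k (tauInv (fine (lev L k) M) μ i) + quadPart L M Rb ν μ k i := by
  set c : ℂ := ((lev L k : ℕ) : ℂ) with hc
  have hc0 : c ≠ 0 := by rw [hc]; exact_mod_cast (lev_neZero L k).ne
  have hcs : star c = c := by rw [hc]; exact star_natCast_complex _
  -- the four transporters as `1 + c⁻¹ w`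
  set x : Tor (fine (lev L k) M) := i.1
  have ex' : (tauInv (fine (lev L k) M) μ i).1 = x - unitVec (fine (lev L k) M) μ := rfl
  have ey : (tau (fine (lev L k) M) ν (tauInv (fine (lev L k) M) μ i)).1 = x - unitVec (fine (lev L k) M) μ + unitVec (fine (lev L k) M) ν := rfl
  have ex : (tau (fine (lev L k) M) μ (tauInv (fine (lev L k) M) μ i)).1 = x := by
    change x - unitVec (fine (lev L k) M) μ + unitVec (fine (lev L k) M) μ = x; abel
  set W1 := wT L M Rb k ν i
  set W2 := wT L M Rb k μ (tau (fine (lev L k) M) ν (tauInv (fine (lev L k) M) μ i))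
  set W3 := wT L M Rb k μ (tauInv (fine (lev L k) M) μ i)
  set W4 := wT L M Rb k ν (tauInv (fine (lev L k) M) μ i)
  have h1 : Rb k ν x = 1 + c⁻¹ • W1 := Rb_eq L M Rb k ν i
  have h2 : Rb k μ (x + unitVec (fine (lev L k) M) ν - unitVec (fine (lev L k) M) μ) = 1 + c⁻¹ • W2 := by
    have h := Rb_eq L M Rb k μ (tau (fine (lev L k) M) ν (tauInv (fine (lev L k) M) μ i))
    rw [ey] at h; rw [← h]; congr 1; abel
  have h3 : Rb k μ (x - unitVec (fine (lev L k) M) μ) = 1 + c⁻¹ • W3 := by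
    have h := Rb_eq L M Rb k μ (tauInv (fine (lev L k) M) μ i); rwa [ex'] at h
  have h4 : Rb k ν (x - unitVec (fine (lev L k) M) μ) = 1 + c⁻¹ • W4 := by
    have h := Rb_eq L M Rb k ν (tauInv (fine (lev L k) M) μ i); rwa [ex'] at h
  -- the μ-difference of `w_ν` at `x′` is `W1 − W4`: `wT k ν (τ_μ (τ_μ⁻¹ i)) = W1`
  have hW1 : wT L M Rb k ν (tau (fine (lev L k) M) μ (tauInv (fine (lev L k) M) μ i)) = W1 := by rw [tau_tauInv]
  -- expand
  have lhs : holTower L M Rb ν μ k i = (c * c) • ((1 + c⁻¹ • W1) * (1 + c⁻¹ • W2)ᴴ - (1 + c⁻¹ • W3)ᴴ * (1 + c⁻¹ • W4)) := by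
    rw [holTower, holField, ← hc, hcs, h1, h2, h3, h4]
  have rhs : linPart L M Rb ν μ k (tauInv (fine (lev L k) M) μ i) + quadPart L M Rb ν μ k i
      = (c • (W1 - W4) + (c • (W2 - W3))ᴴ) + (W1 * W2ᴴ - W3ᴴ * W4) := by
    rw [linPart, quadPart, DqT, DqT, hW1]
  rw [lhs, rhs]
  simp only [Matrix.conjTranspose_add, Matrix.conjTranspose_one, Matrix.conjTranspose_smul, Matrix.conjTranspose_sub, star_inv₀, hcs]
  -- both sides are linear combinations of `1, W1, W2ᴴ, W3ᴴ, W4, W1W2ᴴ, W3ᴴW4`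
  have e1 : (1 + c⁻¹ • W1) * (1 + c⁻¹ • W2ᴴ) = 1 + c⁻¹ • W1 + c⁻¹ • W2ᴴ + (c⁻¹ * c⁻¹) • (W1 * W2ᴴ) := by
    simp only [Matrix.mul_add, Matrix.add_mul, Matrix.one_mul, Matrix.mul_one, Matrix.smul_mul, Matrix.mul_smul, smul_add, smul_smul]; abel
  have e2 : (1 + c⁻¹ • W3ᴴ) * (1 + c⁻¹ • W4) = 1 + c⁻¹ • W3ᴴ + c⁻¹ • W4 + (c⁻¹ * c⁻¹) • (W3ᴴ * W4) := by
    simp only [Matrix.mul_add, Matrix.add_mul, Matrix.one_mul, Matrix.mul_one, Matrix.smul_mul, Matrix.mul_smul, smul_add, smul_smul]; abel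
  rw [e1, e2]
  have hcc : c * c * (c⁻¹ * c⁻¹) = 1 := by field_simp
  have hc1 : c * c * c⁻¹ = c := by field_simp
  simp only [smul_add, smul_sub, smul_smul, hcc, hc1, one_smul]
  abel

/-! ## §2 The regularity structure ((3.35) + (3.36) shapes) and the size of the holonomy tower -/

/-- **THE (3.35)+(3.36)-SHAPE REGULARITY OF SITE TRANSPORTERS** (hypothesis STRUCTURE on data): size `‖w‖ ≤ α`, lattice-Lipschitz
`‖w(y + e_lam) − w(y)‖ ≤ β/L^k` ((3.35) shapes, as in row B5's `RegularTransporters`), and lattice-Lipschitz DIFFERENCE QUOTIENTS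
`‖D_lam w_ν(y + e_ρ) − D_lam w_ν(y)‖ ≤ β₂/L^k` ((3.36) shape: second differences of the connection).  Nothing is asserted about Bałaban's minimisers
or about the existence of such a gauge. [folklore] -/
structure RegularSites (Rb : (k : ℕ) → Fin d → Tor (fine (lev L k) M) → Matrix o o ℂ) (α β β₂ : ℝ) : Prop where
  /-- `α, β, β₂ ≥ 0` -/
  nonneg : 0 ≤ α ∧ 0 ≤ β ∧ 0 ≤ β₂
  /-- size of the connection -/
  size : ∀ k ν (i : idx L M k), ‖wT L M Rb k ν i‖ ≤ α
  /-- lattice-Lipschitz bound of the connection -/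
  lipschitz : ∀ k ν lam (i : idx L M k), ‖wT L M Rb k ν (tau (fine (lev L k) M) lam i) - wT L M Rb k ν i‖ ≤ β / (lev L k : ℕ)
  /-- lattice-Lipschitz bound of the difference quotients (second differences) -/
  lipschitz₂ : ∀ k lam ν ρ (i : idx L M k), ‖DqT L M Rb lam k ν (tau (fine (lev L k) M) ρ i) - DqT L M Rb lam k ν i‖ ≤ β₂ / (lev L k : ℕ)

variable {L M}
variable {Rb : (k : ℕ) → Fin d → Tor (fine (lev L k) M) → Matrix o o ℂ} {α β β₂ : ℝ}

omit hM in
/-- `‖D_lam w_ν‖ ≤ β`. [folklore] -/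
theorem norm_DqT_le (h : RegularSites L M Rb α β β₂) (lam : Fin d) (k : ℕ) (ν : Fin d) (i : idx L M k) : ‖DqT L M Rb lam k ν i‖ ≤ β := by
  have hlev := lev_pos L k
  rw [DqT, norm_smul, Complex.norm_natCast]
  calc ((lev L k : ℕ) : ℝ) * ‖wT L M Rb k ν (tau (fine (lev L k) M) lam i) - wT L M Rb k ν i‖
      ≤ ((lev L k : ℕ) : ℝ) * (β / (lev L k : ℕ)) := mul_le_mul_of_nonneg_left (h.lipschitz k ν lam i) hlev.le
    _ = β := by field_simp

omit hM in
/-- `‖A‖ ≤ 2β`. [folklore] -/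
theorem norm_linPart_le (h : RegularSites L M Rb α β β₂) (ν μ : Fin d) (k : ℕ) (i : idx L M k) : ‖linPart L M Rb ν μ k i‖ ≤ 2 * β := by
  rw [linPart, two_mul]
  exact (norm_add_le _ _).trans (add_le_add (norm_DqT_le h μ k ν i) (by rw [Matrix.l2_opNorm_conjTranspose]; exact norm_DqT_le h ν k μ i))

omit [NeZero L] hM in
/-- `‖B‖ ≤ 2α²`. [folklore] -/
theorem norm_quadPart_le (h : RegularSites L M Rb α β β₂) (ν μ : Fin d) (k : ℕ) (i : idx L M k) :
    ‖quadPart L M Rb ν μ k i‖ ≤ 2 * α ^ 2 := by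
  have hα := h.nonneg.1
  rw [quadPart, two_mul, sq]
  refine (norm_sub_le _ _).trans (add_le_add ?_ ?_)
  · exact (Matrix.l2_opNorm_mul _ _).trans (mul_le_mul (h.size k ν i) (by rw [Matrix.l2_opNorm_conjTranspose]; exact h.size k μ _)
      (norm_nonneg _) hα)
  · exact (Matrix.l2_opNorm_mul _ _).trans (mul_le_mul (by rw [Matrix.l2_opNorm_conjTranspose]; exact h.size k μ _) (h.size k ν _)
      (norm_nonneg _) hα)

omit hM in
/-- **SIZE OF THE HOLONOMY TOWER: `‖holTower‖ ≤ 2β + 2α²`** (the (3.35) shapes suffice). [folklore] -/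
theorem norm_holTower_le (h : RegularSites L M Rb α β β₂) (ν μ : Fin d) (k : ℕ) (i : idx L M k) :
    ‖holTower L M Rb ν μ k i‖ ≤ 2 * β + 2 * α ^ 2 := by
  rw [holTower_eq]
  exact (norm_add_le _ _).trans (add_le_add (norm_linPart_le h ν μ k _) (norm_quadPart_le h ν μ k i))

/-! ## §3 Shifted-site geometry (row B5's, slot-lifted) and the two-level consistency of the holonomy tower -/

section Geometry

variable (L M)

omit [Fintype o] [DecidableEq o] in
/-- the FORWARD dichotomy along the tower: `parT(τ_ν x′) = parT x′` or `= τ_ν(parT x′)`. [cite: King1986, (2.10) p.653 (block pairing, shape)]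
[folklore] -/
theorem parT_tau_cases_lev (k : ℕ) (ν : Fin d) (i : idx L M (k + 1)) :
    parT (lev L k) L M (tau (fine (lev L (k + 1)) M) ν i) = parT (lev L k) L M i ∨
    parT (lev L k) L M (tau (fine (lev L (k + 1)) M) ν i) = tau (fine (lev L k) M) ν (parT (lev L k) L M i) := by
  have key := par_add_unitVec (lev L k) L M ν i.1
  split_ifs at key
  · exact Or.inr (Prod.ext key rfl)
  · exact Or.inl (Prod.ext key rfl)

omit [Fintype o] [DecidableEq o] hM in
/-- `τ_μ(τ_ν(τ_μ⁻¹ p)) = τ_ν p` (translations commute). [folklore] -/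
theorem tau_tau_tauInv {Nf : Fin d → ℕ} [∀ μ, NeZero (Nf μ)] (μ ν : Fin d) (p : Tor Nf × Fin d) :
    tau Nf μ (tau Nf ν (tauInv Nf μ p)) = tau Nf ν p := by
  refine Prod.ext ?_ rfl
  change p.1 - unitVec Nf μ + unitVec Nf ν + unitVec Nf μ = p.1 + unitVec Nf ν
  abel

variable {L M}

/-- a lattice-Lipschitz tower differs by at most `2β/L^k` between `parT(τ_ν τ_μ⁻¹ x′)` and `τ_ν τ_μ⁻¹ (parT x′)` (two dichotomies, at most two
lattice steps). [folklore] -/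
theorem norm_sub_parT_tau_tauInv_le {W : (k : ℕ) → Fin d → (idx L M k → Matrix o o ℂ)} {β : ℝ} (hβ : 0 ≤ β)
    (hlip : ∀ k μ ν (i : idx L M k), ‖W k μ (tau (fine (lev L k) M) ν i) - W k μ i‖ ≤ β / (lev L k : ℕ))
    (k : ℕ) (μ' ν μ : Fin d) (i : idx L M (k + 1)) :
    ‖W k μ' (parT (lev L k) L M (tau (fine (lev L (k + 1)) M) ν (tauInv (fine (lev L (k + 1)) M) μ i)))
      - W k μ' (tau (fine (lev L k) M) ν (tauInv (fine (lev L k) M) μ (parT (lev L k) L M i)))‖ ≤ 2 * β / (lev L k : ℕ) := by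
  have hn : (0 : ℝ) < (lev L k : ℕ) := lev_pos L k
  have h1β : β / (lev L k : ℕ) ≤ 2 * β / (lev L k : ℕ) := div_le_div_of_nonneg_right (by linarith) hn.le
  set p := parT (lev L k) L M i with hp
  set q := tauInv (fine (lev L k) M) μ p with hq
  -- the two single steps: `‖W(p) − W(q)‖ ≤ β/n` (`p = τ_μ q`) and `‖W(q) − W(τ_ν q)‖ ≤ β/n`
  have step1 : ‖W k μ' p - W k μ' q‖ ≤ β / (lev L k : ℕ) := by
    have h := hlip k μ' μ q; rwa [hq, tau_tauInv] at h
  have step2 : ‖W k μ' q - W k μ' (tau (fine (lev L k) M) ν q)‖ ≤ β / (lev L k : ℕ) := by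
    rw [norm_sub_rev]; exact hlip k μ' ν q
  rcases parT_tau_cases_lev L M k ν (tauInv (fine (lev L (k + 1)) M) μ i) with hA | hA <;>
    rcases parT_tauInv_cases_lev k μ i with hB | hB
  · -- value at `p`, target `τ_ν q`: two steps
    rw [hA, hB, ← hp]
    calc ‖W k μ' p - W k μ' (tau (fine (lev L k) M) ν q)‖
        ≤ ‖W k μ' p - W k μ' q‖ + ‖W k μ' q - W k μ' (tau (fine (lev L k) M) ν q)‖ := norm_sub_le_norm_sub_add_norm_sub _ _ _
      _ ≤ β / (lev L k : ℕ) + β / (lev L k : ℕ) := add_le_add step1 step2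
      _ = 2 * β / (lev L k : ℕ) := by ring
  · -- value at `q`, target `τ_ν q`: one step
    rw [hA, hB, ← hp, ← hq]
    exact step2.trans h1β
  · -- value at `τ_ν p = τ_μ (τ_ν q)`, target `τ_ν q`: one step
    rw [hA, hB, ← hp, ← tau_tau_tauInv μ ν p, ← hq]
    exact (hlip k μ' μ _).trans h1β
  · -- exact
    rw [hA, hB, ← hp, ← hq, sub_self, norm_zero]
    exact div_nonneg (by linarith) hn.le

/-- consistency read at a forward-backward-shifted site: `‖W′(τ_ντ_μ⁻¹x′) − W(τ_ντ_μ⁻¹(parT x′))‖ ≤ (βc + 2β)/L^k`. [folklore] -/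
theorem norm_tau_tauInv_sub_le {W : (k : ℕ) → Fin d → (idx L M k → Matrix o o ℂ)} {β βc : ℝ} (hβ : 0 ≤ β)
    (hlip : ∀ k μ ν (i : idx L M k), ‖W k μ (tau (fine (lev L k) M) ν i) - W k μ i‖ ≤ β / (lev L k : ℕ))
    (hcons : ∀ k μ (i : idx L M (k + 1)), ‖W (k + 1) μ i - W k μ (parT (lev L k) L M i)‖ ≤ βc / (lev L k : ℕ))
    (k : ℕ) (μ' ν μ : Fin d) (i : idx L M (k + 1)) :
    ‖W (k + 1) μ' (tau (fine (lev L (k + 1)) M) ν (tauInv (fine (lev L (k + 1)) M) μ i))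
      - W k μ' (tau (fine (lev L k) M) ν (tauInv (fine (lev L k) M) μ (parT (lev L k) L M i)))‖ ≤ (βc + 2 * β) / (lev L k : ℕ) := by
  rw [add_div]
  exact (norm_sub_le_norm_sub_add_norm_sub _ (W k μ' (parT (lev L k) L M (tau (fine (lev L (k + 1)) M) ν
    (tauInv (fine (lev L (k + 1)) M) μ i)))) _).trans (add_le_add (hcons k μ' _) (norm_sub_parT_tau_tauInv_le hβ hlip k μ' ν μ i))

end Geometry

section Consistency

variable {Rb : (k : ℕ) → Fin d → Tor (fine (lev L k) M) → Matrix o o ℂ} {α β β₂ βc βD : ℝ}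

omit hM in
/-- `‖Xᴴ − Yᴴ‖ = ‖X − Y‖`. [folklore] -/
theorem norm_conjTranspose_sub (X Y : Matrix o o ℂ) : ‖Xᴴ - Yᴴ‖ = ‖X - Y‖ := by
  rw [← Matrix.conjTranspose_sub, Matrix.l2_opNorm_conjTranspose]

/-- **CONSISTENCY OF THE LINEAR PART at the backward-shifted site**: `≤ 2(βD + β₂)/L^k` — NE3's consistency of the difference quotients
(`βD`) and their (3.36)-shape Lipschitz bound (`β₂`). [folklore] -/
theorem linPart_consistent (h : RegularSites L M Rb α β β₂)
    (hconsD : ∀ k lam ν (i : idx L M (k + 1)),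
      ‖DqT L M Rb lam (k + 1) ν i - DqT L M Rb lam k ν (parT (lev L k) L M i)‖ ≤ βD / (lev L k : ℕ))
    (ν μ : Fin d) (k : ℕ) (i : idx L M (k + 1)) :
    ‖linPart L M Rb ν μ (k + 1) (tauInv (fine (lev L (k + 1)) M) μ i)
      - linPart L M Rb ν μ k (tauInv (fine (lev L k) M) μ (parT (lev L k) L M i))‖ ≤ 2 * (βD + β₂) / (lev L k : ℕ) := by
  have hβ₂ := h.nonneg.2.2
  have key : ∀ lam ν', ‖DqT L M Rb lam (k + 1) ν' (tauInv (fine (lev L (k + 1)) M) μ i)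
      - DqT L M Rb lam k ν' (tauInv (fine (lev L k) M) μ (parT (lev L k) L M i))‖ ≤ (βD + β₂) / (lev L k : ℕ) :=
    fun lam ν' => norm_tauInv_sub_tauInv_parT_le (W := fun k ν' i => DqT L M Rb lam k ν' i) hβ₂
      (fun k μ ρ i => h.lipschitz₂ k lam μ ρ i) (fun k μ i => hconsD k lam μ i) k ν' μ i
  rw [linPart, linPart, add_sub_add_comm]
  calc _ ≤ ‖DqT L M Rb μ (k + 1) ν (tauInv (fine (lev L (k + 1)) M) μ i) - DqT L M Rb μ k ν (tauInv (fine (lev L k) M) μ (parT (lev L k) L M i))‖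
        + ‖(DqT L M Rb ν (k + 1) μ (tauInv (fine (lev L (k + 1)) M) μ i))ᴴ
          - (DqT L M Rb ν k μ (tauInv (fine (lev L k) M) μ (parT (lev L k) L M i)))ᴴ‖ := norm_add_le _ _
    _ ≤ (βD + β₂) / (lev L k : ℕ) + (βD + β₂) / (lev L k : ℕ) := add_le_add (key μ ν) (by rw [norm_conjTranspose_sub]; exact key ν μ)
    _ = 2 * (βD + β₂) / (lev L k : ℕ) := by ring

/-- `‖X·Y′ᴴ − X₀·Y₀ᴴ‖ ≤ ‖X − X₀‖·‖Y′‖ + ‖X₀‖·‖Y′ − Y₀‖`. [folklore] -/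
theorem norm_mul_conjTranspose_sub_le (X X₀ Y Y₀ : Matrix o o ℂ) :
    ‖X * Yᴴ - X₀ * Y₀ᴴ‖ ≤ ‖X - X₀‖ * ‖Y‖ + ‖X₀‖ * ‖Y - Y₀‖ := by
  have e : X * Yᴴ - X₀ * Y₀ᴴ = (X - X₀) * Yᴴ + X₀ * (Y - Y₀)ᴴ := by
    rw [Matrix.sub_mul, Matrix.conjTranspose_sub, Matrix.mul_sub]; abel
  rw [e]
  calc _ ≤ ‖(X - X₀) * Yᴴ‖ + ‖X₀ * (Y - Y₀)ᴴ‖ := norm_add_le _ _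
    _ ≤ ‖X - X₀‖ * ‖Yᴴ‖ + ‖X₀‖ * ‖(Y - Y₀)ᴴ‖ := add_le_add (Matrix.l2_opNorm_mul _ _) (Matrix.l2_opNorm_mul _ _)
    _ = _ := by rw [Matrix.l2_opNorm_conjTranspose, Matrix.l2_opNorm_conjTranspose]

/-- `‖X′ᴴ·Y′ − Xᴴ·Y‖ ≤ ‖X′ − X‖·‖Y′‖ + ‖X‖·‖Y′ − Y‖`. [folklore] -/
theorem norm_conjTranspose_mul_sub_le (X X₀ Y Y₀ : Matrix o o ℂ) :
    ‖Xᴴ * Y - X₀ᴴ * Y₀‖ ≤ ‖X - X₀‖ * ‖Y‖ + ‖X₀‖ * ‖Y - Y₀‖ := by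
  have e : Xᴴ * Y - X₀ᴴ * Y₀ = (X - X₀)ᴴ * Y + X₀ᴴ * (Y - Y₀) := by
    rw [Matrix.conjTranspose_sub, Matrix.sub_mul, Matrix.mul_sub]; abel
  rw [e]
  calc _ ≤ ‖(X - X₀)ᴴ * Y‖ + ‖X₀ᴴ * (Y - Y₀)‖ := norm_add_le _ _
    _ ≤ ‖(X - X₀)ᴴ‖ * ‖Y‖ + ‖X₀ᴴ‖ * ‖Y - Y₀‖ := add_le_add (Matrix.l2_opNorm_mul _ _) (Matrix.l2_opNorm_mul _ _)
    _ = _ := by rw [Matrix.l2_opNorm_conjTranspose, Matrix.l2_opNorm_conjTranspose]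

/-- **CONSISTENCY OF THE QUADRATIC PART**: `≤ 4α(βc + β)/L^k` — NE3's consistency of `w` (`βc`) and the (3.35) shapes. [folklore] -/
theorem quadPart_consistent (h : RegularSites L M Rb α β β₂) (hβc : 0 ≤ βc)
    (hcons : ∀ k ν (i : idx L M (k + 1)), ‖wT L M Rb (k + 1) ν i - wT L M Rb k ν (parT (lev L k) L M i)‖ ≤ βc / (lev L k : ℕ))
    (ν μ : Fin d) (k : ℕ) (i : idx L M (k + 1)) :
    ‖quadPart L M Rb ν μ (k + 1) i - quadPart L M Rb ν μ k (parT (lev L k) L M i)‖ ≤ 4 * α * (βc + β) / (lev L k : ℕ) := by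
  obtain ⟨hα, hβ, -⟩ := h.nonneg
  have hn : (0 : ℝ) < (lev L k : ℕ) := lev_pos L k
  have hlip : ∀ k μ ν (i : idx L M k), ‖wT L M Rb k μ (tau (fine (lev L k) M) ν i) - wT L M Rb k μ i‖ ≤ β / (lev L k : ℕ) :=
    fun k μ ν i => h.lipschitz k μ ν i
  -- the four factors and their consistencies
  have c1 : ‖wT L M Rb (k + 1) ν i - wT L M Rb k ν (parT (lev L k) L M i)‖ ≤ βc / (lev L k : ℕ) := hcons k ν i
  have c2 := norm_tau_tauInv_sub_le hβ hlip (fun k μ i => hcons k μ i) k μ ν μ i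
  have c3 := norm_tauInv_sub_tauInv_parT_le hβ hlip (fun k μ i => hcons k μ i) k μ μ i
  have c4 := norm_tauInv_sub_tauInv_parT_le hβ hlip (fun k μ i => hcons k μ i) k ν μ i
  rw [quadPart, quadPart, sub_sub_sub_comm]
  refine (norm_sub_le _ _).trans ?_
  have t1 := norm_mul_conjTranspose_sub_le (wT L M Rb (k + 1) ν i) (wT L M Rb k ν (parT (lev L k) L M i))
    (wT L M Rb (k + 1) μ (tau (fine (lev L (k + 1)) M) ν (tauInv (fine (lev L (k + 1)) M) μ i)))
    (wT L M Rb k μ (tau (fine (lev L k) M) ν (tauInv (fine (lev L k) M) μ (parT (lev L k) L M i))))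
  have t2 := norm_conjTranspose_mul_sub_le (wT L M Rb (k + 1) μ (tauInv (fine (lev L (k + 1)) M) μ i))
    (wT L M Rb k μ (tauInv (fine (lev L k) M) μ (parT (lev L k) L M i)))
    (wT L M Rb (k + 1) ν (tauInv (fine (lev L (k + 1)) M) μ i)) (wT L M Rb k ν (tauInv (fine (lev L k) M) μ (parT (lev L k) L M i)))
  have b1 : ‖wT L M Rb (k + 1) ν i - wT L M Rb k ν (parT (lev L k) L M i)‖
      * ‖wT L M Rb (k + 1) μ (tau (fine (lev L (k + 1)) M) ν (tauInv (fine (lev L (k + 1)) M) μ i))‖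
      + ‖wT L M Rb k ν (parT (lev L k) L M i)‖
      * ‖wT L M Rb (k + 1) μ (tau (fine (lev L (k + 1)) M) ν (tauInv (fine (lev L (k + 1)) M) μ i))
        - wT L M Rb k μ (tau (fine (lev L k) M) ν (tauInv (fine (lev L k) M) μ (parT (lev L k) L M i)))‖
      ≤ βc / (lev L k : ℕ) * α + α * ((βc + 2 * β) / (lev L k : ℕ)) :=
    add_le_add (mul_le_mul c1 (h.size _ _ _) (norm_nonneg _) (div_nonneg hβc hn.le))
      (mul_le_mul (h.size _ _ _) c2 (norm_nonneg _) hα)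
  have b2 : ‖wT L M Rb (k + 1) μ (tauInv (fine (lev L (k + 1)) M) μ i) - wT L M Rb k μ (tauInv (fine (lev L k) M) μ (parT (lev L k) L M i))‖
      * ‖wT L M Rb (k + 1) ν (tauInv (fine (lev L (k + 1)) M) μ i)‖
      + ‖wT L M Rb k μ (tauInv (fine (lev L k) M) μ (parT (lev L k) L M i))‖
      * ‖wT L M Rb (k + 1) ν (tauInv (fine (lev L (k + 1)) M) μ i) - wT L M Rb k ν (tauInv (fine (lev L k) M) μ (parT (lev L k) L M i))‖
      ≤ (βc + β) / (lev L k : ℕ) * α + α * ((βc + β) / (lev L k : ℕ)) :=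
    add_le_add (mul_le_mul c3 (h.size _ _ _) (norm_nonneg _) (div_nonneg (by linarith) hn.le))
      (mul_le_mul (h.size _ _ _) c4 (norm_nonneg _) hα)
  refine (add_le_add (t1.trans b1) (t2.trans b2)).trans (le_of_eq ?_)
  field_simp
  ring

/-- **THE HOLONOMY TOWERS ARE BOUNDED TWO-LEVEL-CONSISTENT COLOUR DATA** (the `hz` of `HodgeCorrectionLaws.perturbationLaws_hodgeCorrection_of_shiftLaws`):
from the (3.35)+(3.36)-shape structure `RegularSites Rb α β β₂` and the displayed NE3-type consistencies of the connection (`βc`) and of ALL its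
difference quotients (`βD`): `BoundedBackgroundM L M (holTower L M Rb ν μ) (2β + 2α²) (2(βD + β₂) + 4α(βc + β))`. [folklore] -/
theorem boundedBackgroundM_holTower (h : RegularSites L M Rb α β β₂) (hβc : 0 ≤ βc) (hβD : 0 ≤ βD)
    (hcons : ∀ k ν (i : idx L M (k + 1)), ‖wT L M Rb (k + 1) ν i - wT L M Rb k ν (parT (lev L k) L M i)‖ ≤ βc / (lev L k : ℕ))
    (hconsD : ∀ k lam ν (i : idx L M (k + 1)),
      ‖DqT L M Rb lam (k + 1) ν i - DqT L M Rb lam k ν (parT (lev L k) L M i)‖ ≤ βD / (lev L k : ℕ))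
    (ν μ : Fin d) :
    BoundedBackgroundM L M (holTower L M Rb ν μ) (2 * β + 2 * α ^ 2) (2 * (βD + β₂) + 4 * α * (βc + β)) where
  nonneg := by
    obtain ⟨hα, hβ, hβ₂⟩ := h.nonneg
    exact ⟨by positivity, by positivity⟩
  bound := fun k i => norm_holTower_le h ν μ k i
  consistent := fun k i => by
    rw [holTower_eq, holTower_eq, add_sub_add_comm, add_div]
    exact (norm_add_le _ _).trans (add_le_add (linPart_consistent h hconsD ν μ k i) (quadPart_consistent h hβc hcons ν μ k i))

end Consistency

/-! ## §4 The row-B2.w law with the regularity structure as hypotheses -/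

section Law

variable (a : ℝ) (ha : 0 < a)
variable {Rb : (k : ℕ) → Fin d → Tor (fine (lev L k) M) → Matrix o o ℂ} {α β β₂ βc βD cm : ℝ}

/-- **`PerturbationLaws` FOR THE WEITZENBÖCK CORRECTION FROM (3.35)+(3.36)-SHAPE REGULARITY + NE3's CONSISTENCIES** (and the mixed-shift
`ShiftLaws`, the owner's `shiftLaws_mixed` with `cm = 2Cst`): the target shape for `hodgeCorr L M Rb` with
`κ_w = d²·(2β + 2α²)·Cst`, `C_w = d²·Cst·((2β + 2α²)·cm + (2(βD + β₂) + 4α(βc + β))·Cst)`. [folklore] -/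
theorem perturbationLaws_hodgeCorrection_of_regular (h : RegularSites L M Rb α β β₂) (hβc : 0 ≤ βc) (hβD : 0 ≤ βD)
    (hcons : ∀ k ν (i : idx L M (k + 1)), ‖wT L M Rb (k + 1) ν i - wT L M Rb k ν (parT (lev L k) L M i)‖ ≤ βc / (lev L k : ℕ))
    (hconsD : ∀ k lam ν (i : idx L M (k + 1)),
      ‖DqT L M Rb lam (k + 1) ν i - DqT L M Rb lam k ν (parT (lev L k) L M i)‖ ≤ βD / (lev L k : ℕ))
    (hS : ∀ μ ν, ShiftLaws L M a ha (fun k => ((shiftM (fine (lev L k) M) μ)ᴴ * shiftM (fine (lev L k) M) ν) ⊗ₖ (1 : Matrix o o ℂ)) cm) :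
    PerturbationLaws (Dc L M a ha) (hodgeCorr L M Rb) (Jc L M)
      ((d : ℝ) ^ 2 * ((2 * β + 2 * α ^ 2) * Cst d a))
      (fun k => (d : ℝ) ^ 2 * (Cst d a * ((2 * β + 2 * α ^ 2) * cm + (2 * (βD + β₂) + 4 * α * (βc + β)) * Cst d a)) * ((L : ℝ)⁻¹) ^ k) :=
  perturbationLaws_hodgeCorrection_of_shiftLaws L M a ha (fun ν μ => boundedBackgroundM_holTower h hβc hβD hcons hconsD ν μ) hS

end Law

end Summit.QuantumFields.BalabanUV.T4Continuum.HolonomyTowerRegular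

end
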